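import Summits.Ventures.HSemireg.WedgeBoxHigh

/-!
# Venture HSemireg — THEOREM K∘T for the box (6/8)

HONEST FRAMING. Part of the Lean index of the computation cell `pub-hsemireg` (seat p3; Sunday enclosure of the
FORMULA-N kernel assets of seats th-7 / th-6, ENCLOSURE-PLAN-p3.md).  Finite-dimensional exterior algebra over a field ONLY:
no variety, no cohomology theory, no semiregularity map is constructed here; nothing here says that HC / HC_CM / HC_AV holds;
no Literature fact is declared or used.  The geometric DICTIONARY (why these ranks are the `HT`-side box ranks of the cell's
STRUCTURE.md §1 / theory/FORMULA-N.md) lives in theory/FORMULA-N-th7.md PART B §A.3 / §N and is NOT asserted in Lean.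

THEOREM K∘T for the BOX of two point pairs (FORMULA-N PART A §2.3 / PART B §L; th-7 theory/th7/BoxRank.lean v4 sha256/16
88aeb4a1de514ae6, l.1361–1566), file 6 of 8 — generators `I n := Fin (4n)` in four blocks `A 0 = X`, `A 1 = Y` (factor 1), `C 0 = X′`,
`C 1 = Y′` (factor 2); the coefficient-matrix box `boxClass c := Σ_{α,β} c α β • E_{A α ∪ C β}` and the HONEST box `fac1 a * fac2 a′`;
ranks of `θ ↦ θ ∧ box` on `⋀^k` in every degree: `4C(2n,k) − 4C(n,k)` (0 < k < n), the degree-n PURITY DROP `4C(2n,n) − 6` on the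
decomposable locus, `4C(2n,k) − 4C(n,k−n)` (n < k < 2n), `1` in degrees 0 and 2n; one citable form `finrank_range_wedgeMap_fac_mul_all`
(file 8).  No permutation sign is ever evaluated.  th-7's statements and proofs, unchanged (namespace `HSemiregBox` ↦
`Summit.Ventures.HSemireg.WedgeBox`; this family's Fin-indexed `B K n s` is its own, kept apart from `Wedge.B` / `WedgePair.B` by namespace).
Part III/2: independence of the `Jk`-images, the two splitting lemmas, `range_eq_span_vecJk`.
-/

open Module Set Set.powersetCard

namespace Summit.Ventures.HSemireg.WedgeBox

variable (K : Type*) [Field K] {n : ℕ}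

section DegreeHigh

variable {k : ℕ}

variable (c : Fin 2 → Fin 2 → K)

/-- `Jk` as a subtype of `Rel n k`. -/
def jkRel (s : Jk n k) : Rel n k := ⟨s.1, (mem_Jk.mp s.2).1⟩

/-- the family `E_s ∧ v`, `s ∈ Jk`. -/
noncomputable def vecJk (s : Jk n k) : HT K n := vec K c (jkRel s)

/-- pivot coordinates of the images of the `Jk`-monomials: diagonal with non-zero pivots. -/
lemma coord_piv_vecJk (hn : 0 < n) (hnk : n < k) (s s' : Jk n k) :
    (B K n).coord (piv (jkRel s)) (vecJk K c s') = if s' = s then pivCoeff K c (jkRel s) else 0 := by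
  classical
  rw [vecJk, vec, coord_B_mul_boxClass]
  have hds : Disjoint s.1 (P n (αc s.1) (βc s.1)) := disjoint_P_canonical (mem_Jk.mp s.2).1
  have hterm : ∀ α β, c α β * sgn K (relPc (jkRel s')) (Ppc n α β) *
      (if (relPc (n := n) (jkRel s')).val ∪ P n α β = piv (jkRel s) then (1 : K) else 0) =
      if s' = s ∧ α = αc s.1 ∧ β = βc s.1 then pivCoeff K c (jkRel s) else 0 := by
    intro α β
    by_cases hd : Disjoint (relPc (n := n) (jkRel s')).val (P n α β)
    · by_cases he : (relPc (n := n) (jkRel s')).val ∪ P n α β = piv (jkRel s)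
      · obtain ⟨hα, hβ, hss⟩ := key_high hn hnk s.2 s'.2 hd he
        have hs's : s' = s := Subtype.ext hss
        rw [if_pos he, mul_one, if_pos ⟨hs's, hα, hβ⟩, pivCoeff, hs's, hα, hβ]
        rfl
      · rw [if_neg he, mul_zero, if_neg]
        rintro ⟨rfl, rfl, rfl⟩
        exact he rfl
    · rw [sgn_of_not_disjoint K hd, mul_zero, zero_mul, if_neg]
      rintro ⟨rfl, rfl, rfl⟩
      exact hd hds
  simp_rw [hterm]
  by_cases hs : s' = s
  · simp only [hs, true_and, if_true]
    rw [Finset.sum_eq_single (αc s.1) (fun α _ hα => by simp [hα]) (by simp),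
      Finset.sum_eq_single (βc s.1) (fun β _ hβ => by simp [hβ]) (by simp)]
    simp
  · simp [hs]

/-- the dual functionals on `Jk`. -/
noncomputable def fnlJk (s : Jk n k) : Module.Dual K (HT K n) := fnl K c (jkRel s)

/-- the dual functionals are dual to the `Jk`-images (degrees `n < k < 2n`). -/
lemma fnlJk_vecJk (hn : 0 < n) (hnk : n < k) (hc : ∀ α β, c α β ≠ 0) (s s' : Jk n k) :
    fnlJk K c s (vecJk K c s') = if s' = s then 1 else 0 := by
  rw [fnlJk, fnl, LinearMap.smul_apply, coord_piv_vecJk K c hn hnk, smul_eq_mul]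
  split_ifs with h
  · exact inv_mul_cancel₀ (pivCoeff_ne_zero K c hc _)
  · exact mul_zero _

/-- the images of the `Jk`-monomials are linearly independent. -/
theorem vecJk_linearIndependent (hn : 0 < n) (hnk : n < k) (hc : ∀ α β, c α β ≠ 0) :
    LinearIndependent K (vecJk K (n := n) (k := k) c) := by
  apply LinearIndependent.of_pairwise_dual_eq_zero_one _ (fnlJk K c)
  · intro s s' hss'
    rw [fnlJk_vecJk K c hn hnk hc, if_neg (Ne.symm hss')]
  · intro s
    rw [fnlJk_vecJk K c hn hnk hc, if_pos rfl]

/-! #### The partner of a monomial containing `A 1` (resp. `C 1`) lies in `Jk`. -/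

/-- structure of a relevant monomial containing `A 1`: `s = A 1 ∪ R`, `R ⊆ C δ`, `card R = k − n`. -/
lemma exists_of_A1_subset (hnk : n < k) {s : Finset (I n)} (hs : s ∈ Rel n k) (hA : A n 1 ⊆ s) :
    ∃ δ, s \ A n 1 ⊆ C n δ ∧ (s \ A n 1).card = k - n ∧ s = A n 1 ∪ (s \ A n 1) := by
  obtain ⟨⟨γ, δ⟩, hsMix⟩ := mem_Mix_of_Rel_high hnk hs
  obtain ⟨hsub, hcard, -, -⟩ := mem_Mix.mp hsMix
  have hn' : (A n 1).Nonempty := by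
    have hle := Finset.card_le_card hsub
    rw [card_P, hcard] at hle
    rw [← Finset.card_pos, card_A]; omega
  obtain ⟨i, hi⟩ := hn'
  have hγ : γ = 1 := eq_of_mem_A_of_mem_P hi (hsub (hA hi))
  subst hγ
  refine ⟨δ, ?_, ?_, (Finset.union_sdiff_of_subset hA).symm⟩
  · intro j hj
    rw [Finset.mem_sdiff] at hj
    have := hsub hj.1
    rw [P, Finset.mem_union] at this
    exact this.resolve_left hj.2
  · rw [Finset.card_sdiff_of_subset hA, hcard, card_A]

/-- a relevant monomial containing `C 1` splits as `R ∪ C 1` with `R` inside one factor-1 block. -/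
lemma exists_of_C1_subset (hnk : n < k) {s : Finset (I n)} (hs : s ∈ Rel n k) (hC : C n 1 ⊆ s) :
    ∃ γ, s \ C n 1 ⊆ A n γ ∧ (s \ C n 1).card = k - n ∧ s = (s \ C n 1) ∪ C n 1 := by
  obtain ⟨⟨γ, δ⟩, hsMix⟩ := mem_Mix_of_Rel_high hnk hs
  obtain ⟨hsub, hcard, -, -⟩ := mem_Mix.mp hsMix
  have hn' : (C n 1).Nonempty := by
    have hle := Finset.card_le_card hsub
    rw [card_P, hcard] at hle
    rw [← Finset.card_pos, card_C]; omega
  obtain ⟨i, hi⟩ := hn'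
  have hδ : δ = 1 := eq_of_mem_C_of_mem_P hi (hsub (hC hi))
  subst hδ
  refine ⟨γ, ?_, ?_, (Finset.sdiff_union_of_subset hC).symm⟩
  · intro j hj
    rw [Finset.mem_sdiff] at hj
    have := hsub hj.1
    rw [P, Finset.mem_union] at this
    exact this.resolve_right hj.2
  · rw [Finset.card_sdiff_of_subset hC, hcard, card_C]

/-- the A-partner `A 0 ∪ R` is in `Jk` (`n < k < 2n`). -/
lemma A0_union_mem_Jk (hn : 0 < n) (hnk : n < k) (hk2 : k < n + n) {R : Finset (I n)} {δ : Fin 2}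
    (hR : R ⊆ C n δ) (hRc : R.card = k - n) : A n 0 ∪ R ∈ Jk n k := by
  have hRA : ∀ α, Disjoint R (A n α) := fun α =>
    Finset.disjoint_of_subset_left hR (disjoint_A_C n α δ).symm
  have hcard : (A n 0 ∪ R).card = k := by
    rw [Finset.card_union_of_disjoint (hRA 0).symm, card_A, hRc]; omega
  have hdisj : Disjoint (A n 0 ∪ R) (P n 1 (other δ)) := by
    rw [Finset.disjoint_union_left, disjoint_P_iff, disjoint_P_iff]
    exact ⟨⟨disjoint_A_A n (by decide), disjoint_A_C n 0 _⟩, hRA 1,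
      Finset.disjoint_of_subset_left hR (disjoint_C_C n (other_ne δ).symm)⟩
  refine mem_Jk.mpr ⟨mem_Rel_of_disjoint hcard hdisj, ?_, ?_⟩
  · intro hsub
    obtain ⟨i, hi⟩ : (A n 1).Nonempty := by rw [← Finset.card_pos, card_A]; exact hn
    have := hsub hi
    rw [Finset.mem_union] at this
    rcases this with h | h
    · exact Finset.disjoint_left.mp (disjoint_A_A n (show (1 : Fin 2) ≠ 0 by decide)) hi h
    · exact Finset.disjoint_left.mp (hRA 1) h hi
  · intro hsub
    have hsub' : C n 1 ⊆ R := by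
      intro i hi
      have := hsub hi
      rw [Finset.mem_union] at this
      rcases this with h | h
      · exact (Finset.disjoint_left.mp (disjoint_A_C n 0 1) h hi).elim
      · exact h
    have := Finset.card_le_card hsub'
    rw [card_C, hRc] at this
    omega

/-- the C-partner `R ∪ C 0` is in `Jk` (`n < k < 2n`). -/
lemma union_C0_mem_Jk (hn : 0 < n) (hnk : n < k) (hk2 : k < n + n) {R : Finset (I n)} {γ : Fin 2}
    (hR : R ⊆ A n γ) (hRc : R.card = k - n) : R ∪ C n 0 ∈ Jk n k := by
  have hRC : ∀ β, Disjoint R (C n β) := fun β =>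
    Finset.disjoint_of_subset_left hR (disjoint_A_C n γ β)
  have hcard : (R ∪ C n 0).card = k := by
    rw [Finset.card_union_of_disjoint (hRC 0), card_C, hRc]; omega
  have hdisj : Disjoint (R ∪ C n 0) (P n (other γ) 1) := by
    rw [Finset.disjoint_union_left, disjoint_P_iff, disjoint_P_iff]
    exact ⟨⟨Finset.disjoint_of_subset_left hR (disjoint_A_A n (other_ne γ).symm), hRC 1⟩,
      (disjoint_A_C n _ 0).symm, disjoint_C_C n (by decide)⟩
  refine mem_Jk.mpr ⟨mem_Rel_of_disjoint hcard hdisj, ?_, ?_⟩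
  · intro hsub
    have hsub' : A n 1 ⊆ R := by
      intro i hi
      have := hsub hi
      rw [Finset.mem_union] at this
      rcases this with h | h
      · exact h
      · exact (Finset.disjoint_left.mp (disjoint_A_C n 1 0) hi h).elim
    have := Finset.card_le_card hsub'
    rw [card_A, hRc] at this
    omega
  · intro hsub
    obtain ⟨i, hi⟩ : (C n 1).Nonempty := by rw [← Finset.card_pos, card_C]; exact hn
    have := hsub hi
    rw [Finset.mem_union] at this
    rcases this with h | h
    · exact Finset.disjoint_left.mp (hRC 1) h hi
    · exact Finset.disjoint_left.mp (disjoint_C_C n (show (1 : Fin 2) ≠ 0 by decide)) hi h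

/-- for the honest box, the range in degree `k` (`n < k < 2n`) is spanned by the `Jk`-family. -/
theorem range_eq_span_vecJk (hn : 0 < n) (hnk : n < k) (hk2 : k < n + n) {a a' : Fin 2 → K}
    (ha : ∀ α, a α ≠ 0) (ha' : ∀ β, a' β ≠ 0) :
    LinearMap.range (wedgeMap K n k (fac1 K n a * fac2 K n a')) =
      Submodule.span K (Set.range (vecJk K (n := n) (k := k) (boxCoeff K (n := n) a a'))) := by
  rw [fac1_mul_fac2, range_eq_span_vec]
  apply le_antisymm
  · rw [Submodule.span_le]
    rintro _ ⟨s, rfl⟩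
    rw [SetLike.mem_coe]
    by_cases hJ : s.1 ∈ Jk n k
    · exact Submodule.subset_span ⟨⟨s.1, hJ⟩, rfl⟩
    · have hs : A n 1 ⊆ s.1 ∨ C n 1 ⊆ s.1 := by
        have := s.2
        rw [mem_Jk, not_and, not_and_or, not_not, not_not] at hJ
        exact hJ this
      rcases hs with hs | hs
      · obtain ⟨δ, hR, hRc, hsR⟩ := exists_of_A1_subset hnk s.2 hs
        set R := s.1 \ A n 1 with hRdef
        have hJ0 : A n 0 ∪ R ∈ Jk n k := A0_union_mem_Jk hn hnk hk2 hR hRc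
        have hRA : ∀ α, Disjoint R (A n α) := fun α =>
          Finset.disjoint_of_subset_left hR (disjoint_A_C n α δ).symm
        have hv : vec K (boxCoeff K (n := n) a a') s =
            ((sgn K (pcOf R) (Apc n 1))⁻¹ * (a 0 * (-1 : K) ^ (n * n) * (a 1)⁻¹) * sgn K (pcOf R) (Apc n 0)) •
              vecJk K (boxCoeff K (n := n) a a') ⟨A n 0 ∪ R, hJ0⟩ := by
          rw [vecJk, vec, vec, ← fac1_mul_fac2]
          have e1 : B K n (relPc s) = (B K n) (A n 1 ∪ R) := by rw [B_apply_pc, coe_relPc, hsR]; rfl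
          have e0 : B K n (relPc (jkRel ⟨A n 0 ∪ R, hJ0⟩)) = (B K n) (A n 0 ∪ R) := by rw [B_apply_pc]; rfl
          rw [e1, e0, B_A1_union_mul K hn ha R (hRA 0) (hRA 1)]
        rw [hv]
        exact Submodule.smul_mem _ _ (Submodule.subset_span ⟨_, rfl⟩)
      · obtain ⟨γ, hR, hRc, hsR⟩ := exists_of_C1_subset hnk s.2 hs
        set R := s.1 \ C n 1 with hRdef
        have hJ0 : R ∪ C n 0 ∈ Jk n k := union_C0_mem_Jk hn hnk hk2 hR hRc
        have hRC : ∀ β, Disjoint R (C n β) := fun β =>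
          Finset.disjoint_of_subset_left hR (disjoint_A_C n γ β)
        have hv : vec K (boxCoeff K (n := n) a a') s =
            ((sgn K (pcOf R) (Cpc n 1))⁻¹ * (a' 0 * (-1 : K) ^ (n * n) * (a' 1)⁻¹) * sgn K (pcOf R) (Cpc n 0)) •
              vecJk K (boxCoeff K (n := n) a a') ⟨R ∪ C n 0, hJ0⟩ := by
          rw [vecJk, vec, vec, ← fac1_mul_fac2]
          have e1 : B K n (relPc s) = (B K n) (R ∪ C n 1) := by rw [B_apply_pc, coe_relPc, hsR]; rfl
          have e0 : B K n (relPc (jkRel ⟨R ∪ C n 0, hJ0⟩)) = (B K n) (R ∪ C n 0) := by rw [B_apply_pc]; rfl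
          rw [e1, e0, B_union_C1_mul K hn ha' R (hRC 0) (hRC 1)]
        rw [hv]
        exact Submodule.smul_mem _ _ (Submodule.subset_span ⟨_, rfl⟩)
  · apply Submodule.span_mono
    rintro _ ⟨s, rfl⟩
    exact ⟨jkRel s, rfl⟩

end DegreeHigh

end Summit.Ventures.HSemireg.WedgeBox
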